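import Literature.MathematicalPhysics.QuantumFieldTheory.BalabanImbrieJaffe1984to88.BIJ85BlockAveragesTorus
import Literature.MathematicalPhysics.QuantumFieldTheory.Balaban1983to89.T4CubeChartCircle

/-!
# `BalabanImbrieJaffe1984to88.BIJ88Eq537Jacobian` — T. Bałaban, J. Imbrie, A. Jaffe, *Effective action and cluster properties of the
abelian Higgs model*, Commun. Math. Phys. **114** (1988) 257–315 [BalabanImbrieJaffe1988], p. 280, the sentence closing **(5.3.7)**:
*"The factor e_k/2π arises because du_b = (e_k/2π)dA_b."* — the Jacobian between the normalized Haar measure `du_b` of one `U(1)`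
bond variable and Lebesgue measure `dA_b` on the Lie-algebra variable of (2.12)/(3.12) `u_b = e^{ie_kA_b}`, PROVED for the Haar datum
of the carrier of record (companion of `BIJ88Eq536Linearization`, which proves the constraint-set content of (5.3.6)–(5.3.7)).

statement-level skeleton of published theorems with citation tags; proofs where landed; nothing here is a claim about the Yang–Mills mass gap

PDF held: `paper:balaban1988-cmp114-bij-abelian-higgs-effective-action` (journal page = PDF page + 256), p. 280 [PDF 24] read as the image
`HOME/lit-balaban-r16/renders/cmp114/original-p024-x2.png`; p. 274 [PDF 18] (*"The measure du^{(j)} is the normalized measure on U(1),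
∫du^{(j)} = 1"*, `original-p018-x2.png`).

CITATION HEADER (lean-in-tree rule).  Part of the lit-balaban TYPED SKELETON (HOME `run/shared/lean/pub/lit-balaban/`), PHASE-2 proof
seat p31 gen 5 (unit `lit-balaban-p31-g5`; TAKING line HOME/STATUS.md 2026-08-21T06:09:53Z, *"the Jacobian sentence «du_b =
(e_k/2π)dA_b» if tractable as a measure identity"*).  WHAT IS REPRODUCED: row `C2.Eq5.3.1-5.3.7` of
`HOME/lit-balaban-r16/ROWS-C2-part2.md` (owner r16), member (5.3.7), last sentence of p. 280.

THE PRINTED TEXT (verbatim, p. 280): *"δ(v/Qu) = δ_{Λ₁^{(k)′*c}}(v/Qu) δ_{Λ₁^{(k)′*}}((e_k/2π)QA′), (5.3.6) where δ_{Λ₁^{(k)′*}}((e_k/2π)QA′)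
= Π_{b′∈Λ₁^{(k)′*}} δ((e_k/2π)(QA′)(b′)). (5.3.7) The factor e_k/2π arises because du_b = (e_k/2π)dA_b."*

CARRIERS (all of record; nothing re-declared).  `U(1) = BIJ88Sect3Statements.U1 = Matrix.unitaryGroup (Fin 1) ℂ` with the cell's Haar
datum `HaarData.haar` (`UnitaryModel.instHaarDataUnitaryGroup`; `∫du = 1`, p. 274) — the one-bond factor of the product measure `𝒟u =
fieldMeasure` of every C2 file; the parametrisation `A ↦ e^{iA} ∈ U(1)` is r18 gen 4's `BIJ85BlockAveragesTorus.expU1` (the exponential of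
(2.10)/(3.12) on this carrier), which IS the cell's angle chart `T4CubeChartCircle.expU` (private `expU1_eq_expU`, by `rfl`); the identification
of the Haar datum with the normalized angle measure `(2π)⁻¹dθ` on `(−π, π]` is the cell's `T4CubeChartCircle.map_expU_angleMeasure`
(from the tree's `CircleHaar.map_exp_angleMeasure`).

WHAT IS PROVED (theorems only; 0 `sorry`, standard axioms, no `Prop`-valued fact introduced).
* `integral_haar_eq_angle` — `∫ f(u) du = (2π)⁻¹ ∫_{(−π,π]} f(e^{iθ}) dθ` (the normalized measure on `U(1)` in the angle `θ`);
* **`integral_haar_eq_charge`** — for a charge `e_k > 0`: **`∫ f(u) du = (e_k/2π) ∫_{−π/e_k}^{π/e_k} f(e^{ie_kA}) dA`**, i.e.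
  *"du_b = (e_k/2π)dA_b"* for the Lie-algebra variable `A_b = (ie_k)^{−1} ln u_b` of (2.12) ranging over one period — the origin of the
  factor `e_k/2π` in front of `(QA′)(b′)` in (5.3.6)–(5.3.7);
* `integral_window_eq_charge` — the same substitution on a window: `(2π)⁻¹ ∫_{−e_kS}^{e_kS} f(e^{iθ}) dθ = (e_k/2π) ∫_{−S}^{S} f(e^{ie_kA}) dA`
  (the form met when a δ-function in `A` is smeared over `|A| ≤ S`).
* the MEASURE form: `map_expU1_chargeMeasure` — `(A ↦ e^{ie_kA})_*((e_k/2π)·dA|_{(−π/e_k,π/e_k]}) = du` (so *"du_b = (e_k/2π)dA_b"* literally, as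
  push-forward), `measurePreserving_expU1_charge`, and bondwise on the whole torus `measurePreserving_expU1_charge_pi` /
  **`integral_fieldMeasure_eq_charge`**: `∫ F 𝒟u = (e_k/2π)^{#bonds} ∫_{period box} F((e^{ie_kA_b})_b) Π_b dA_b` for the product Haar measure
  `𝒟u = fieldMeasure P j U1` of every C2 file.
Imports: r18's `BIJ85BlockAveragesTorus` (for `expU1`) and the cell's `T4CubeChartCircle` (Literature); standard axioms.
-/

namespace Literature.MathematicalPhysics.QuantumFieldTheory.BalabanImbrieJaffe1984to88.BIJ88Eq537Jacobian

open Literature.MathematicalPhysics.QuantumFieldTheory.Balaban1983to89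
open BIJ88Sect3Statements (U1 toC)
open BIJ85BlockAveragesTorus (expU1 toC_expU1)
open _root_.MeasureTheory
open scoped Real

noncomputable section

/-- kernel: r18's `expU1` (`θ ↦ e^{iθ} ∈ U(1)` through `circleEquivU1`) IS the cell's angle chart `T4CubeChartCircle.expU` (through
`ofCircle`) — the same `1 × 1` unitary matrix `(e^{iθ})`. [folklore] -/
private theorem expU1_eq_expU : (expU1 : ℝ → U1) = T4CubeChartCircle.expU := by
  funext θ
  apply Subtype.ext
  rfl

/-- **The normalized measure on `U(1)` in the angle**: `∫ f(u) du = (2π)⁻¹ ∫_{(−π,π]} f(e^{iθ}) dθ` for the Haar datum of the carrier of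
record (p. 274: *"The measure du^{(j)} is the normalized measure on U(1), ∫du^{(j)} = 1"*). [cite: BalabanImbrieJaffe1988, (4.1) p.274] -/
theorem integral_haar_eq_angle {E : Type*} [NormedAddCommGroup E] [NormedSpace ℝ E] (f : U1 → E)
    (hf : AEStronglyMeasurable f (HaarData.haar : Measure U1)) :
    ∫ u, f u ∂(HaarData.haar : Measure U1) = (2 * π)⁻¹ • ∫ θ in Set.Ioc (-π) π, f (expU1 θ) := by
  rw [← T4CubeChartCircle.map_expU_angleMeasure] at hf ⊢
  rw [integral_map T4CubeChartCircle.measurable_expU.aemeasurable hf, CircleHaar.angleMeasure, integral_smul_measure,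
    ENNReal.toReal_inv, ENNReal.toReal_ofReal (by positivity), expU1_eq_expU]

/-- **p. 280: *"The factor e_k/2π arises because du_b = (e_k/2π)dA_b."*** — for a charge `e_k > 0` and the Lie-algebra variable
`A_b` of (2.12)/(3.12), `u_b = e^{ie_kA_b}`, ranging over one period `(−π/e_k, π/e_k]`:
**`∫ f(u) du = (e_k/2π) ∫_{−π/e_k}^{π/e_k} f(e^{ie_kA}) dA`** (normalized Haar measure on the left, Lebesgue measure on the right).
[cite: BalabanImbrieJaffe1988, (5.3.7) p.280] -/
theorem integral_haar_eq_charge {E : Type*} [NormedAddCommGroup E] [NormedSpace ℝ E] (f : U1 → E)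
    (hf : AEStronglyMeasurable f (HaarData.haar : Measure U1)) {ek : ℝ} (hek : 0 < ek) :
    ∫ u, f u ∂(HaarData.haar : Measure U1) = (ek / (2 * π)) • ∫ A in (-(π / ek))..(π / ek), f (expU1 (ek * A)) := by
  rw [integral_haar_eq_angle f hf, ← intervalIntegral.integral_of_le (by linarith [Real.pi_pos] : -π ≤ π)]
  have h := intervalIntegral.smul_integral_comp_mul_left (f := fun θ => f (expU1 θ)) (a := -(π / ek)) (b := π / ek) ek
  have h1 : ek * -(π / ek) = -π := by field_simp
  have h2 : ek * (π / ek) = π := by field_simp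
  rw [h1, h2] at h
  rw [← h, smul_smul]
  congr 1
  field_simp

/-- **The same Jacobian on an `A`-window** (the form met when a δ-function in `A` is smeared over `|A| ≤ S`):
`(2π)⁻¹ ∫_{−e_kS}^{e_kS} f(e^{iθ}) dθ = (e_k/2π) ∫_{−S}^{S} f(e^{ie_kA}) dA` — the substitution `θ = e_kA` on a sub-interval of the period
(any real `e_k`, `S`). [cite: BalabanImbrieJaffe1988, (5.3.7) p.280] -/
theorem integral_window_eq_charge {E : Type*} [NormedAddCommGroup E] [NormedSpace ℝ E] (f : U1 → E) (ek S : ℝ) :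
    (2 * π)⁻¹ • ∫ θ in (-(ek * S))..(ek * S), f (expU1 θ) = (ek / (2 * π)) • ∫ A in (-S)..S, f (expU1 (ek * A)) := by
  have h := intervalIntegral.smul_integral_comp_mul_left (f := fun θ => f (expU1 θ)) (a := -S) (b := S) ek
  rw [mul_neg] at h
  rw [← h, smul_smul]
  congr 1
  field_simp

/-! ## The measure form: `du_b = (e_k/2π)dA_b` bond by bond, and `𝒟u = Π_b (e_k/2π)dA_b` on the period box -/

/-- kernel: `A ↦ e^{ie_kA}` is measurable. [cite: BalabanImbrieJaffe1988, (5.3.7) p.280] -/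
theorem measurable_expU1_charge (ek : ℝ) : Measurable fun A : ℝ => expU1 (ek * A) := by
  rw [expU1_eq_expU]
  exact T4CubeChartCircle.measurable_expU.comp (measurable_const_mul ek)

/-- **`du_b = (e_k/2π)dA_b` as an identity of measures**: the map `A ↦ u = e^{ie_kA}` pushes `(e_k/2π)·dA` restricted to one period
`(−π/e_k, π/e_k]` to the normalized Haar measure `du` of the carrier (`e_k > 0`). [cite: BalabanImbrieJaffe1988, (5.3.7) p.280] -/
theorem map_expU1_chargeMeasure {ek : ℝ} (hek : 0 < ek) :
    (ENNReal.ofReal (ek / (2 * π)) • (volume : Measure ℝ).restrict (Set.Ioc (-π / ek) (π / ek))).map (fun A => expU1 (ek * A))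
      = (HaarData.haar : Measure U1) := by
  have hme : Measurable (fun A : ℝ => ek * A) := measurable_const_mul ek
  have hexp : Measurable (expU1 : ℝ → U1) := by rw [expU1_eq_expU]; exact T4CubeChartCircle.measurable_expU
  have hcomp : (fun A => expU1 (ek * A)) = expU1 ∘ (fun A => ek * A) := rfl
  have hpre : (fun A : ℝ => ek * A) ⁻¹' Set.Ioc (-π) π = Set.Ioc (-π / ek) (π / ek) := Set.preimage_const_mul_Ioc₀ _ _ hek
  have hinner : ((volume : Measure ℝ).restrict (Set.Ioc (-π / ek) (π / ek))).map (fun A : ℝ => ek * A)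
      = ENNReal.ofReal ek⁻¹ • (volume : Measure ℝ).restrict (Set.Ioc (-π) π) := by
    rw [← hpre, ← Measure.restrict_map hme measurableSet_Ioc, Real.map_volume_mul_left hek.ne', abs_of_pos (inv_pos.2 hek),
      Measure.restrict_smul]
  rw [hcomp, ← Measure.map_map hexp hme, Measure.map_smul, hinner, Measure.map_smul, Measure.map_smul, smul_smul,
    ← T4CubeChartCircle.map_expU_angleMeasure, CircleHaar.angleMeasure, Measure.map_smul, expU1_eq_expU]
  congr 1
  rw [← ENNReal.ofReal_mul (by positivity), ← ENNReal.ofReal_inv_of_pos (by positivity)]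
  congr 1
  field_simp

/-- kernel: `A ↦ e^{ie_kA}` is measure preserving from `(e_k/2π)dA` on one period to `du`. [cite: BalabanImbrieJaffe1988, (5.3.7) p.280] -/
theorem measurePreserving_expU1_charge {ek : ℝ} (hek : 0 < ek) :
    MeasurePreserving (fun A => expU1 (ek * A))
      (ENNReal.ofReal (ek / (2 * π)) • (volume : Measure ℝ).restrict (Set.Ioc (-π / ek) (π / ek))) (HaarData.haar : Measure U1) :=
  ⟨measurable_expU1_charge ek, map_expU1_chargeMeasure hek⟩

variable {P : Params} {j : ℕ}

/-- **`𝒟u = Π_b du_b = Π_b (e_k/2π)dA_b`**: the bondwise parametrisation `A ↦ (e^{ie_kA_b})_b` is measure preserving from the product of the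
charge measures to the product Haar measure `𝒟u = fieldMeasure` of the torus (`e_k > 0`). [cite: BalabanImbrieJaffe1988, (5.3.7) p.280] -/
theorem measurePreserving_expU1_charge_pi (P : Params) (j : ℕ) {ek : ℝ} (hek : 0 < ek) :
    MeasurePreserving (fun A : PBond P j → ℝ => (fun b : PBond P j => expU1 (ek * A b) : GaugeField P j U1))
      (Measure.pi fun _ : PBond P j => ENNReal.ofReal (ek / (2 * π)) • (volume : Measure ℝ).restrict (Set.Ioc (-π / ek) (π / ek)))
      (fieldMeasure P j U1) := by
  unfold fieldMeasure
  exact measurePreserving_pi _ _ fun _ => measurePreserving_expU1_charge hek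

/-- kernel: the charge measure of one period is a finite measure (total mass `1`, but finiteness is all that is used). [folklore] -/
private theorem isFiniteMeasure_chargeMeasure {ek : ℝ} :
    IsFiniteMeasure (ENNReal.ofReal (ek / (2 * π)) • (volume : Measure ℝ).restrict (Set.Ioc (-π / ek) (π / ek))) := by
  refine ⟨?_⟩
  rw [Measure.smul_apply, Measure.restrict_apply MeasurableSet.univ, Set.univ_inter, Real.volume_Ioc, smul_eq_mul]
  exact ENNReal.mul_lt_top ENNReal.ofReal_lt_top ENNReal.ofReal_lt_top

/-- **`𝒟u` in the Lie-algebra variables**: for every `𝒟u`-a.e.-strongly measurable `F` and charge `e_k > 0`,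
`∫ F(u) 𝒟u = (e_k/2π)^{#bonds} ∫_{(−π/e_k, π/e_k]^{bonds}} F((e^{ie_kA_b})_b) Π_b dA_b` — the product form of *"du_b = (e_k/2π)dA_b"* behind
the factors `e_k/2π` of (5.3.6)–(5.3.7). [cite: BalabanImbrieJaffe1988, (5.3.7) p.280] -/
theorem integral_fieldMeasure_eq_charge {E : Type*} [NormedAddCommGroup E] [NormedSpace ℝ E] (F : GaugeField P j U1 → E)
    (hF : AEStronglyMeasurable F (fieldMeasure P j U1)) {ek : ℝ} (hek : 0 < ek) :
    ∫ u, F u ∂(fieldMeasure P j U1) = (ek / (2 * π)) ^ Fintype.card (PBond P j) •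
      ∫ A in Set.pi Set.univ (fun _ : PBond P j => Set.Ioc (-π / ek) (π / ek)), F (fun b => expU1 (ek * A b) : GaugeField P j U1) := by
  have hmp := measurePreserving_expU1_charge_pi P j hek
  rw [← hmp.map_eq] at hF ⊢
  refine (integral_map hmp.measurable.aemeasurable hF).trans ?_
  haveI : IsFiniteMeasure (ENNReal.ofReal (ek / (2 * π)) • (volume : Measure ℝ).restrict (Set.Ioc (-π / ek) (π / ek))) :=
    isFiniteMeasure_chargeMeasure
  rw [CircleHaar.pi_const_smul, ← Measure.restrict_pi_pi, volume_pi, integral_smul_measure, ENNReal.toReal_pow,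
    ENNReal.toReal_ofReal (by positivity)]

end

end Literature.MathematicalPhysics.QuantumFieldTheory.BalabanImbrieJaffe1984to88.BIJ88Eq537Jacobian
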